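import Summits.ABC.IUTFork.Cor312LicenceOfGradedReach
import Summits.ABC.IUTFork.Cor312HullGainMover
import Summits.ABC.IUTFork.Cor312HullContentInclusion
import Summits.ABC.IUTFork.Repair.RHSlotReach
import Literature.IUT.LogVolume.LogUnitsSubmodule
import HarnessLib

/-!
# [IUTchIII] Cor. 3.12 — the (xi-f) licence cell at a packet of ANY local type from ONE far-reaching log-unit per place:
# the inner-radius-free, different-free INHABITED-side test («cond3» of the R-W WINDOW-TABLE, with `r_w` eliminated)

PROOF-ONLY file (D-0012: 0 definitions, 0 `Prop` facts, no instance, no notation) of the abc-iut cell — D-0079 RESCUE sub-cell R-W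
«WINDOW Θ-SIDE INEQUALITY», lane U → P+, claim «W:U2-LEVEL-WITNESS» (HOME/STATUS 2026-08-26T19:42:35Z), seat abc-iut-w4-d026 gen 8.
TAKES NO SIDE on [IUTchIII] Cor. 3.12 (S. Mochizuki, *Inter-universal Teichmüller theory III*, kurims manuscript, Cor. 3.12 p. 173 l. 41 –
p. 174 l. 19; Step (xi) (xi-f) p. 184 l. 26–29; Thm. 3.11 (i) (Ind2) p. 154) or on any author: every statement is about OUR typed objects —
abc-iut-c312-7's sharp settings `Real.settingDHVolSharp` / `Real.settingPrVolSharp` (ANY pilot data `X`, ANY fibre over `p`: several places,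
wild ramification allowed), Dupuy–Hilado's typed (Ind2) `Real.ismDH` (ALL shell-preserving bicontinuous lattice automorphisms of
`log_p(𝒪^×_x)`, [DupuyHilado2025] §4.9) acting independently on every (capsule slot, place). The packet-level licence is a
STRONGER-THAN-PRINT reading of Step (xi-f) (ADJUDICATION-SPEC §2 (G1′)); typed ≠ proved; instantiated ≠ endorsed.

WHY. abc-iut-rp-h3's `Cor312LicenceOfGradedReach` proves the licence cell at `(i+1, p)` from a GRADED REACH (a uniform unit-slot gain `r`
over the fibre and a pilot cell) and, in `…_of_latticeLevels`, reads both off the EXACT lattice levels of `1` and of `t_{Θ,i+1,x}` in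
`log_p(𝒪^×_x)` — lattice-specific data (and the level of `t_Θ` itself may be deep). HERE the graded reach is discharged from ONE-SIDED data
with NO inner radius, NO different and NO level computation:
* §1 (generic, any `K` of the MLF class; the integer `u ∉ log_p(𝒪_K^×)` itself is abc-iut-rh-typ-12's
  `Repair.RHSlotReach.exists_norm_le_one_not_mem_logUnits`, `μ(log_p 𝒪^×) = p^{−(f+m)} < 1`, consumed BY NAME): `exists_level_of_not_mem_logUnits` —
  such a `u` sits at an exact level `p^{−m}·log_p(𝒪^×) ∖ p^{1−m}·log_p(𝒪^×)`, `m ≥ 1`; `exists_primitive_of_mem_logUnits` — every non-zero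
  log-unit `w` is `p^{−k}·w₀` (`k ≥ 0`) with `w₀ ∉ p·log_p(𝒪^×)` PRIMITIVE and `‖w‖ ≤ ‖w₀‖` (Weil *BNT* II §2).
* §2 **`qRegion_subset_thetaHull_settingDHVolSharp_of_farReach`** — at `(i+1, p)`, ANY fibre: per place `x | p` ONE non-zero
  `w_x ∈ log_p(𝒪^×_x)`, an integer `c_x` with `‖p^{c_x}‖ ≤ ‖t_{Θ,i+1,x}‖`, and `r ≥ 0` with `r ≤ p·‖w_x‖`; THEN the cell
  **`‖t_{q,x}‖ ≤ p^{1−c_x}·‖w_x‖·r^{i+1}`** at every `x` gives `qRegion (i+1) p ⊆ thetaHull (i+1) p`. Mechanism: the integer `u_x ∉ log_p(𝒪^×_x)`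
  of §1 has level `−m ≤ −1`; (Ind2) is transitive on each primitive level (abc-iut-w5-d180, through abc-iut-rp-h3's
  `exists_mem_ism_apply_eq_of_sameLevel`), so a mover carries `u_x` to `p^{−m}·w₀` (norm `≥ p·‖w_x‖`: the unit-slot GAIN) and another carries
  `p^{c_x}·u_x = t_Θ·y` (`‖y‖ ≤ 1`) to `p^{c_x−m}·w₀` (norm `≥ p^{1−c_x}·‖w_x‖`: the pilot REACH); then `…_of_gradedReach`.
  `…settingPrVolSharp…` twin; `…_of_norm_le` (the trivial cell `‖t_q‖ ≤ ‖t_Θ‖`: good primes, `p = 2`). RELATION (no twin intended): this is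
  abc-iut-lens-wuc-1's R-H row-15 `SlotReachWindow` at `n₀ ≡ 1` in NORM currency with a UNIFORM gain per fibre (abc-iut-rp-d3's
  `Repair.RHSlotReachGlue.licence_settingPrVolSharp_of_slotReachWindow` is the tuple-wise form in `(e, ϖ, n₀, λ, m_Θ, m_q)` currency — use it
  when donor places differ or an inner certificate `n₀ > 1` is available); here NO uniformizer, ramification index or order bookkeeping enters.
* §3 `licence_settingPrVolSharp_of_farReach` (at every `(p, i+1)` EITHER the far-reach data OR the trivial cell ⟹ the typed Licence),
  `exists_qPinned_and_hull_settingPrVolSharp_of_farReach` (branch C's «∃ ρ qK, QPinned ∧ PilotKummerCompatHull»; integral `t_q` at the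
  label `0`); the typed Statement then follows by abc-iut-c312-1's `Thm311ToCor312.statement_of_licence` (cf. `…_of_gradedReach`).

COLUMN READING (neutral; numbers, not adjectives; for the R-W WINDOW-TABLE / HOME/abc-iut-W-num-6 «cond3»). In `K_x`-normalised exponents
(`‖t_Θ‖ = ‖ϖ‖^{M}`, `‖t_q‖ = ‖ϖ‖^{m_q}`, `‖w_x‖ = ‖ϖ‖^{s_x}`, `e = e_x`, one local type over `p`), with `c_x = ⌈M/e⌉`, the cell reads
**`m_q ≥ e·(⌈M/e⌉ − 1) + s_x + (i+1)·(s_x − e)`** — abc-iut-w4-d026's desk formula (a) (HOME/STATUS 2026-08-26T14:37:26Z) / W-num-6's «cond3»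
with the content exponent `r_w` ELIMINATED; best `s_x` = the outer exponent `R_out = min_a (p^a − a·e)` (abc-iut-c312-3, `UnitLogMaxNorm`),
any attained `s_x` is admissible. It COINCIDES with abc-iut-w5-d180's exact tame cell at lattice-tame places and is WEAKER than
abc-iut-c312-5's exact cell by `≈ (i+1)(R_in − 1) + (i+1)(D − e + 1)` orders at wild places: a SUFFICIENT test only. HONEST SCOPE: OUR sharp
containers, DH's (Ind2); nothing here bears on the printed GLOBAL inequality or on initial Θ-data; nothing asserts or refutes [IUTchIII]
Cor. 3.12. [cite: DupuyHilado2025, §3.4, §3.9, §4.7, §4.9] [cite: WeilBNT1967, Ch. II §2, Th. 1–2] [cite: Mochizuki2012, IUTchIII Cor. 3.12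
p. 173–175, Step (xi-f) p. 184; IUTchIV Prop. 1.4 (ii) p. 13] [claim: Mochizuki2012, status: disputed] for every IUT locution. Axioms: standard.
-/


noncomputable section

open Set Function NumberField IsDedekindDomain Metric
open scoped Pointwise

namespace Summit.ABC.IUTFork.Thm311.Real

open Cor312 Cor312Vol Literature.IUT.LogThetaLattice Literature.IUT.LogVolume
  Literature.NumberTheory.NumberFields Literature.NumberTheory.GaloisRepresentations.Ultrametric

/-! ## §1. Generic: an integer outside `log_p(𝒪^×)`, its level, and primitive log-units -/

section Generic

variable (p : ℕ) [hp : Fact p.Prime] (K : Type*) [NontriviallyNormedField K] [instK : NormedAlgebra ℚ_[p] K] [IsUltrametricDist K]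
  [ProperSpace K]

/-- `ℤ_p`-stability of `log_p(𝒪^×)` for a `ℚ_p`-scalar of norm `≤ 1` (abc-iut-S6 `smul_mem_logUnits`). [cite: WeilBNT1967, Ch. II §2, Th. 1] -/
theorem smul_mem_logUnits_of_norm_le_one {a : ℚ_[p]} (ha : ‖a‖ ≤ 1) {z : K} (hz : z ∈ logUnits K) : a • z ∈ logUnits K := by
  set c : ℤ_[p] := ⟨a, ha⟩ with hc
  have h := smul_mem_logUnits p K c hz
  rw [← algebraMap_smul ℚ_[p] c z] at h
  exact h

omit [IsUltrametricDist K] [ProperSpace K] in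
/-- A multiple `a·w₀` of a PRIMITIVE log-unit `w₀ ∉ p·log_p(𝒪^×)` lies outside `(p·a)·log_p(𝒪^×)` (`a ≠ 0`). [cite: WeilBNT1967, Ch. II §2, Th. 1] -/
theorem smul_not_mem_mul_smul_logUnits {a : ℚ_[p]} (ha : a ≠ 0) {w₀ : K}
    (hw₀ : w₀ ∉ (p : ℚ_[p]) • (logUnits K : Set K)) :
    a • w₀ ∉ ((p : ℚ_[p]) * a) • (logUnits K : Set K) := by
  rintro ⟨w', hw', h⟩
  refine hw₀ ⟨w', hw', smul_right_injective K ha ?_⟩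
  change a • ((p : ℚ_[p]) • w') = a • w₀
  rw [smul_smul, mul_comm a]
  exact h

/-- **The level of an integer outside `log_p(𝒪^×)`.** If `u ∉ log_p(𝒪_K^×)` then, for some `m ≥ 1`, `u ∈ p^{−m}·log_p(𝒪^×)` and
`u ∉ p·p^{−m}·log_p(𝒪^×)` (least `p`-power scaling into the compact open lattice; `m ≤ 0` would put `u` in the `ℤ_p`-stable lattice).
[cite: WeilBNT1967, Ch. II §2, Th. 1–2] -/
theorem exists_level_of_not_mem_logUnits {u : K} (hu : u ∉ logUnits K) :
    ∃ m : ℤ, 1 ≤ m ∧ u ∈ ((p : ℚ_[p]) ^ (-m)) • (logUnits K : Set K) ∧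
      u ∉ ((p : ℚ_[p]) * (p : ℚ_[p]) ^ (-m)) • (logUnits K : Set K) := by
  have hp0 : (p : ℚ_[p]) ≠ 0 := Nat.cast_ne_zero.mpr hp.out.ne_zero
  have hp1 : (1 : ℝ) ≤ p := by exact_mod_cast hp.out.one_lt.le
  have hu0 : u ≠ 0 := by
    rintro rfl
    exact hu (zero_mem_logUnits (p := p))
  obtain ⟨m, hm, hm1⟩ := exists_zpow_smul_mem_and_not_mem p (L := logUnits K)
    ((isOpen_logUnits p K).mem_nhds (zero_mem_logUnits (p := p))) (isCompact_logUnits p K).isBounded hu0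
  have hback : ((p : ℚ_[p]) ^ (-m)) • (((p : ℚ_[p]) ^ m) • u) = u := by
    rw [smul_smul, ← zpow_add₀ hp0, neg_add_cancel, zpow_zero, one_smul]
  have h1m : 1 ≤ m := by
    by_contra hlt
    push Not at hlt
    apply hu
    rw [← hback]
    refine smul_mem_logUnits_of_norm_le_one p K ?_ hm
    rw [Padic.norm_p_zpow, neg_neg]
    exact zpow_le_one_of_nonpos₀ hp1 (by omega)
  refine ⟨m, h1m, ⟨_, hm, hback⟩, ?_⟩
  rintro ⟨w', hw', h⟩
  apply hm1
  have hw'eq : ((p : ℚ_[p]) ^ (m - 1)) • u = w' := by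
    rw [← h, smul_smul, ← zpow_one_add₀ hp0, ← zpow_add₀ hp0, show m - 1 + (1 + -m) = 0 by ring, zpow_zero, one_smul]
  rw [hw'eq]
  exact hw'

/-- **Primitive log-units.** Every non-zero `w ∈ log_p(𝒪_K^×)` is `p^{k}·w₀` (`k ≥ 0`) with `w₀ ∈ log_p(𝒪^×) ∖ p·log_p(𝒪^×)` PRIMITIVE and
`‖w‖ ≤ ‖w₀‖`. [cite: WeilBNT1967, Ch. II §2, Th. 1–2] -/
theorem exists_primitive_of_mem_logUnits {w : K} (hw : w ∈ logUnits K) (hw0 : w ≠ 0) :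
    ∃ w₀ ∈ logUnits K, w₀ ∉ (p : ℚ_[p]) • (logUnits K : Set K) ∧ ‖w‖ ≤ ‖w₀‖ := by
  have hp0 : (p : ℚ_[p]) ≠ 0 := Nat.cast_ne_zero.mpr hp.out.ne_zero
  have hp1 : (1 : ℝ) ≤ p := by exact_mod_cast hp.out.one_lt.le
  obtain ⟨m, hm, hm1⟩ := exists_zpow_smul_mem_and_not_mem p (L := logUnits K)
    ((isOpen_logUnits p K).mem_nhds (zero_mem_logUnits (p := p))) (isCompact_logUnits p K).isBounded hw0
  have hm0 : m ≤ 0 := by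
    by_contra hlt
    push Not at hlt
    apply hm1
    refine smul_mem_logUnits_of_norm_le_one p K ?_ hw
    rw [Padic.norm_p_zpow]
    exact zpow_le_one_of_nonpos₀ hp1 (by omega)
  refine ⟨((p : ℚ_[p]) ^ m) • w, hm, ?_, ?_⟩
  · rintro ⟨w', hw', h⟩
    apply hm1
    have hw'eq : ((p : ℚ_[p]) ^ (m - 1)) • w = w' := by
      have h' : (p : ℚ_[p])⁻¹ • (((p : ℚ_[p]) ^ m) • w) = w' := by
        rw [← h, smul_smul, inv_mul_cancel₀ hp0, one_smul]
      rw [← h', smul_smul, zpow_sub_one₀ hp0, mul_comm]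
    rw [hw'eq]
    exact hw'
  · rw [norm_smul, Padic.norm_p_zpow]
    exact le_mul_of_one_le_left (norm_nonneg _) (one_le_zpow₀ hp1 (by omega))

end Generic

/-! ## §2. The licence cell at `(i+1, p)` from one far-reaching log-unit per place -/

section Cell

variable {F : Type} [Field F] [NumberField F] (X : PilotData F) {logv : PadicLogs F} (hlog : LogvAnalytic logv)
  (M : Type) [Field M] [NumberField M]
  (archPk : ∀ (j : (thetaIndex X).Label) (vQ : (thetaIndex X).VQ), Set ((logShellsDH X logv).Packet j vQ))
  (archSub : ∀ (j : (thetaIndex X).Label) (v : (thetaIndex X).V),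
    Set ((logShellsDH X logv).Packet j ((thetaIndex X).over v)))
  (Ψ : ℤ → ∀ v : (thetaIndex X).V, v ∈ (thetaIndex X).Vbad → Set ((logShellsDH X logv).StarPacket v))
  (act : ℤ → ∀ v : (thetaIndex X).V, v ∈ (thetaIndex X).Vbad →
    (logShellsDH X logv).StarPacket v → Module.End ℚ ((logShellsDH X logv).StarPacket v))
  (Mmod : ℤ → ∀ j : (thetaIndex X).LabelStar, Set ((logShellsDH X logv).GlobalPacket j.1))
  (region : ℤ → ∀ j : (thetaIndex X).LabelStar, FinDivisor M → ∀ vQ : (thetaIndex X).VQ,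
    Set ((logShellsDH X logv).Packet j.1 vQ))
  (n : ℤ) {HT : Type} {LogLink : HT → HT → Type} {IsFull : ∀ {s t : HT}, LogLink s t → Prop}
  (lat : LGPGaussianLogThetaLattice LogLink IsFull)
  {Frd : Type} {IsoF : Frd → Frd → Type} {Ob : Frd → Type} {realify : Frd → Frd} {Strip : Type}
  {IsoS : Strip → Strip → Type} {Mv : ∀ v : (thetaIndex X).V, v ∈ (thetaIndex X).Vbad → Type}
  [∀ v h, Monoid (Mv v h)]
  (sig : GlobalLGPFrobenioidSignature (thetaIndex X).lstar (thetaIndex X).V (· ∈ (thetaIndex X).Vbad)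
    Frd IsoF Ob realify Strip IsoS Mv)
  (split : SplittingMonoids Mv) {ObΔ : Type} {N : ∀ v : (thetaIndex X).V, v ∈ (thetaIndex X).Vbad → Type}
  [∀ v h, Monoid (N v h)] (qData : QPilotData ObΔ N)
  (tq : ∀ (pp : Nat.Primes) (x : (thetaIndex X).Fibre (.inr pp)), haveI : Fact (pp : ℕ).Prime := ⟨pp.2⟩; kOf X pp.1 x)
  (t : ∀ (pp : Nat.Primes) (_ : Fin X.lstar) (x : (thetaIndex X).Fibre (.inr pp)),
    haveI : Fact (pp : ℕ).Prime := ⟨pp.2⟩; kOf X pp.1 x)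
  (htq0 : ∀ pp x, tq pp x ≠ 0)
  (htq1 : ∀ (pp : Nat.Primes) (x : (thetaIndex X).Fibre (.inr pp)),
    haveI : Fact (pp : ℕ).Prime := ⟨pp.2⟩; placeOf X pp.1 x ∉ X.S → ‖tq pp x‖ = 1)
  (col : ℤ → Column (logShellsDH X logv))

/-- **THE UNIT-SLOT GAIN FROM ONE NON-ZERO LOG-UNIT** (any place `x | p`, any local type): for `w ∈ log_p(𝒪^×_x)`, `w ≠ 0`, some typed
(Ind2)-mover carries some integer `u` (`‖u‖ ≤ 1`, the `u ∉ log_p(𝒪^×_x)` of §1) to a vector of norm `≥ p·‖w‖`.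
[cite: WeilBNT1967, Ch. II §2, Th. 1] [cite: DupuyHilado2025, §4.9] [claim: Mochizuki2012, status: disputed] -/
theorem exists_unitGain_of_mem_logUnits (pp : Nat.Primes) [Fact (pp : ℕ).Prime] (x : (thetaIndex X).Fibre (.inr pp))
    {w : kOf X pp.1 x} (hw : w ∈ logUnits (kOf X pp.1 x)) (hw0 : w ≠ 0) :
    ∃ g ∈ (logShellsDH X logv).ism x.1, ∃ u : kOf X pp.1 x, ‖u‖ ≤ 1 ∧
      (pp.1 : ℝ) * ‖w‖ ≤ ‖(presAt X hlog pp).φ x (g (((presAt X hlog pp).φ x).symm u))‖ := by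
  have hp0 : (pp.1 : ℚ_[pp.1]) ≠ 0 := Nat.cast_ne_zero.mpr (Fact.out : (pp : ℕ).Prime).ne_zero
  have hp1 : (1 : ℝ) ≤ (pp.1 : ℝ) := by exact_mod_cast (Fact.out : (pp : ℕ).Prime).one_lt.le
  obtain ⟨u, hu1, huΛ⟩ := Repair.RHSlotReach.exists_norm_le_one_not_mem_logUnits pp.1 (kOf X pp.1 x)
  obtain ⟨m, hm1, huc, hucp⟩ := exists_level_of_not_mem_logUnits pp.1 (kOf X pp.1 x) huΛ
  obtain ⟨w₀, hw₀, hw₀p, hww₀⟩ := exists_primitive_of_mem_logUnits pp.1 (kOf X pp.1 x) hw hw0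
  set a : ℚ_[pp.1] := (pp.1 : ℚ_[pp.1]) ^ (-m) with ha
  have ha0 : a ≠ 0 := zpow_ne_zero _ hp0
  obtain ⟨g, hg, hgz⟩ := exists_mem_ism_apply_eq_of_sameLevel X hlog pp x a huc hucp (Set.smul_mem_smul_set hw₀)
    (smul_not_mem_mul_smul_logUnits pp.1 (kOf X pp.1 x) ha0 hw₀p)
  refine ⟨g, hg, u, hu1, ?_⟩
  rw [hgz]
  change (pp.1 : ℝ) * ‖w‖ ≤ ‖(a • w₀ : kOf X pp.1 x)‖
  rw [norm_smul, ha, Padic.norm_p_zpow, neg_neg]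
  refine mul_le_mul ?_ hww₀ (norm_nonneg _) (zpow_nonneg (zero_le_one.trans hp1) _)
  calc ((pp.1 : ℝ)) = (pp.1 : ℝ) ^ (1 : ℤ) := (zpow_one _).symm
    _ ≤ (pp.1 : ℝ) ^ m := zpow_le_zpow_right₀ hp1 hm1

/-- **THE PILOT REACH FROM ONE NON-ZERO LOG-UNIT** (any place `x | p`): for `w ∈ log_p(𝒪^×_x)`, `w ≠ 0`, and an integer `c` with
`‖p^c‖ ≤ ‖t_{Θ,i+1,x}‖`, some typed (Ind2)-mover carries `t_{Θ,i+1,x}·y` (`y := t_Θ⁻¹·p^c·u`, `‖y‖ ≤ 1`) to a vector of norm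
`≥ p^{1−c}·‖w‖`; hence the pilot cell of the graded reach holds as soon as `‖t_{q,x}‖ ≤ p^{1−c}·‖w‖·R`.
[cite: WeilBNT1967, Ch. II §2, Th. 1] [cite: DupuyHilado2025, §3.9, §4.9] [claim: Mochizuki2012, status: disputed] -/
theorem exists_pilotReach_of_mem_logUnits (pp : Nat.Primes) [Fact (pp : ℕ).Prime] (x : (thetaIndex X).Fibre (.inr pp))
    (i : Fin X.lstar) {w : kOf X pp.1 x} (hw : w ∈ logUnits (kOf X pp.1 x)) (hw0 : w ≠ 0) {c : ℤ}
    (hc : ‖((pp.1 : ℚ_[pp.1]) ^ c)‖ ≤ ‖t pp i x‖) {R : ℝ} (hR0 : 0 ≤ R)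
    (hcell : ‖tq pp x‖ ≤ (pp.1 : ℝ) ^ (1 - c) * ‖w‖ * R) :
    ∃ g ∈ (logShellsDH X logv).ism x.1, ∃ y : kOf X pp.1 x, ‖y‖ ≤ 1 ∧
      ‖tq pp x‖ ≤ ‖(presAt X hlog pp).φ x (g (((presAt X hlog pp).φ x).symm (t pp i x * y)))‖ * R := by
  have hprime : (pp : ℕ).Prime := Fact.out
  have hp0 : (pp.1 : ℚ_[pp.1]) ≠ 0 := Nat.cast_ne_zero.mpr hprime.ne_zero
  have hp1 : (1 : ℝ) ≤ (pp.1 : ℝ) := by exact_mod_cast hprime.one_lt.le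
  have hpc0 : ((pp.1 : ℚ_[pp.1]) ^ c) ≠ 0 := zpow_ne_zero _ hp0
  have ht0 : t pp i x ≠ 0 := norm_pos_iff.mp ((norm_pos_iff.mpr hpc0).trans_le hc)
  obtain ⟨u, hu1, huΛ⟩ := Repair.RHSlotReach.exists_norm_le_one_not_mem_logUnits pp.1 (kOf X pp.1 x)
  obtain ⟨m, hm1, huc, hucp⟩ := exists_level_of_not_mem_logUnits pp.1 (kOf X pp.1 x) huΛ
  obtain ⟨w₀, hw₀, hw₀p, hww₀⟩ := exists_primitive_of_mem_logUnits pp.1 (kOf X pp.1 x) hw hw0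
  -- the integer `y = t⁻¹·p^c·u` and the vector `t·y = p^c·u` at the level `p^c·p^{−m}`
  set y : kOf X pp.1 x := (t pp i x)⁻¹ * (((pp.1 : ℚ_[pp.1]) ^ c) • u) with hy
  have hty : t pp i x * y = ((pp.1 : ℚ_[pp.1]) ^ c) • u := by rw [hy, mul_inv_cancel_left₀ ht0]
  have hy1 : ‖y‖ ≤ 1 := by
    rw [hy, norm_mul, norm_inv, norm_smul]
    have htpos : 0 < ‖t pp i x‖ := norm_pos_iff.mpr ht0
    rw [inv_mul_le_iff₀ htpos, mul_one]
    calc ‖(pp.1 : ℚ_[pp.1]) ^ c‖ * ‖u‖ ≤ ‖(pp.1 : ℚ_[pp.1]) ^ c‖ * 1 := mul_le_mul_of_nonneg_left hu1 (norm_nonneg _)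
      _ ≤ ‖t pp i x‖ := by rw [mul_one]; exact hc
  set a : ℚ_[pp.1] := (pp.1 : ℚ_[pp.1]) ^ c * (pp.1 : ℚ_[pp.1]) ^ (-m) with ha
  have ha0 : a ≠ 0 := mul_ne_zero hpc0 (zpow_ne_zero _ hp0)
  have hlev : ((pp.1 : ℚ_[pp.1]) ^ c) • u ∈ a • (logUnits (kOf X pp.1 x) : Set (kOf X pp.1 x)) := by
    obtain ⟨u', hu', hu'eq⟩ := Set.mem_smul_set.mp huc
    refine Set.mem_smul_set.mpr ⟨u', hu', ?_⟩
    rw [ha, ← smul_smul, hu'eq]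
  have hlevp : ((pp.1 : ℚ_[pp.1]) ^ c) • u ∉ ((pp.1 : ℚ_[pp.1]) * a) • (logUnits (kOf X pp.1 x) : Set (kOf X pp.1 x)) := by
    intro hmem
    obtain ⟨u', hu', h⟩ := Set.mem_smul_set.mp hmem
    refine hucp (Set.mem_smul_set.mpr ⟨u', hu', smul_right_injective (kOf X pp.1 x) hpc0 ?_⟩)
    show ((pp.1 : ℚ_[pp.1]) ^ c) • ((((pp.1 : ℚ_[pp.1])) * (pp.1 : ℚ_[pp.1]) ^ (-m)) • u') = ((pp.1 : ℚ_[pp.1]) ^ c) • u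
    rw [← h, smul_smul, ha]
    congr 1
    ring
  obtain ⟨g, hg, hgz⟩ := exists_mem_ism_apply_eq_of_sameLevel X hlog pp x a hlev hlevp (Set.smul_mem_smul_set hw₀)
    (smul_not_mem_mul_smul_logUnits pp.1 (kOf X pp.1 x) ha0 hw₀p)
  refine ⟨g, hg, y, hy1, ?_⟩
  rw [hty, hgz]
  change ‖tq pp x‖ ≤ ‖(a • w₀ : kOf X pp.1 x)‖ * R
  rw [norm_smul, ha, norm_mul, Padic.norm_p_zpow, Padic.norm_p_zpow, neg_neg]
  refine hcell.trans (mul_le_mul_of_nonneg_right ?_ hR0)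
  -- `p^{1-c}·‖w‖ ≤ p^{-c}·p^m·‖w₀‖`
  have hpow : (pp.1 : ℝ) ^ (1 - c) ≤ (pp.1 : ℝ) ^ (-c) * (pp.1 : ℝ) ^ m := by
    rw [← zpow_add₀ (by positivity : (pp.1 : ℝ) ≠ 0)]
    exact zpow_le_zpow_right₀ hp1 (by omega)
  exact mul_le_mul hpow hww₀ (norm_nonneg _) (by positivity)

/-- **THE FAR-REACH CELL.** At the packet `(i+1, p)` of the sharp DH setting, for ANY fibre over `p` (several places, any local type): given
`r ≥ 0` and, at every place `x | p`, ONE non-zero log-unit `w_x` with `r ≤ p·‖w_x‖` and an integer `c_x` with `‖p^{c_x}‖ ≤ ‖t_{Θ,i+1,x}‖`, the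
cell **`‖t_{q,x}‖ ≤ p^{1−c_x}·‖w_x‖·r^{i+1}`** at every `x` implies `qRegion (i+1) p ⊆ thetaHull (i+1) p`. No inner radius, no different, no
lattice level is consumed (abc-iut-rp-h3's graded reach, discharged by §1). [cite: DupuyHilado2025, §3.9, §4.9] [cite: WeilBNT1967, Ch. II §2, Th. 1]
[cite: Mochizuki2012, IUTchIII Cor. 3.12 p. 174–175, Step (xi-f) p. 184] [claim: Mochizuki2012, status: disputed] -/
theorem qRegion_subset_thetaHull_settingDHVolSharp_of_farReach (pp : Nat.Primes) [Fact (pp : ℕ).Prime] (i : Fin (thetaIndex X).lstar)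
    {r : ℝ} (hr : 0 ≤ r) (w : ∀ x : (thetaIndex X).Fibre (.inr pp), kOf X pp.1 x) (c : (thetaIndex X).Fibre (.inr pp) → ℤ)
    (hw : ∀ x, w x ∈ logUnits (kOf X pp.1 x) ∧ w x ≠ 0 ∧ r ≤ (pp.1 : ℝ) * ‖w x‖)
    (hc : ∀ x, ‖((pp.1 : ℚ_[pp.1]) ^ c x)‖ ≤ ‖t pp i x‖)
    (hcell : ∀ x, ‖tq pp x‖ ≤ (pp.1 : ℝ) ^ (1 - c x) * ‖w x‖ * r ^ ((i : ℕ) + 1)) :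
    (settingDHVolSharp X hlog M archPk archSub Ψ act Mmod region n lat sig split qData tq t htq0 htq1).qRegion
        (Setting.labelSucc i) (.inr pp) ⊆
      (settingDHVolSharp X hlog M archPk archSub Ψ act Mmod region n lat sig split qData tq t htq0 htq1).thetaHull
        (Setting.labelSucc i) (.inr pp) :=
  qRegion_subset_thetaHull_settingDHVolSharp_of_gradedReach X hlog M archPk archSub Ψ act Mmod region n lat sig split qData tq t htq0 htq1
    pp i hr
    (fun x => by
      obtain ⟨g, hg, u, hu, hle⟩ := exists_unitGain_of_mem_logUnits X hlog pp x (hw x).1 (hw x).2.1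
      exact ⟨g, hg, u, hu, (hw x).2.2.trans hle⟩)
    fun x => exists_pilotReach_of_mem_logUnits X hlog tq t pp x i (hw x).1 (hw x).2.1 (hc x) (pow_nonneg hr _) (hcell x)

/-- … the same cell at the PRINT-NORMALISED sharp setting `settingPrVolSharp` (abc-iut-c312-7; same regions and frames).
[cite: DupuyHilado2025, §3.9, §4.9] [claim: Mochizuki2012, status: disputed] -/
theorem qRegion_subset_thetaHull_settingPrVolSharp_of_farReach (pp : Nat.Primes) [Fact (pp : ℕ).Prime] (i : Fin (thetaIndex X).lstar)
    {r : ℝ} (hr : 0 ≤ r) (w : ∀ x : (thetaIndex X).Fibre (.inr pp), kOf X pp.1 x) (c : (thetaIndex X).Fibre (.inr pp) → ℤ)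
    (hw : ∀ x, w x ∈ logUnits (kOf X pp.1 x) ∧ w x ≠ 0 ∧ r ≤ (pp.1 : ℝ) * ‖w x‖)
    (hc : ∀ x, ‖((pp.1 : ℚ_[pp.1]) ^ c x)‖ ≤ ‖t pp i x‖)
    (hcell : ∀ x, ‖tq pp x‖ ≤ (pp.1 : ℝ) ^ (1 - c x) * ‖w x‖ * r ^ ((i : ℕ) + 1)) :
    (settingPrVolSharp X hlog M archPk archSub Ψ act Mmod region n lat sig split qData tq t htq0 htq1).qRegion
        (Setting.labelSucc i) (.inr pp) ⊆
      (settingPrVolSharp X hlog M archPk archSub Ψ act Mmod region n lat sig split qData tq t htq0 htq1).thetaHull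
        (Setting.labelSucc i) (.inr pp) :=
  qRegion_subset_thetaHull_settingDHVolSharp_of_farReach X hlog M archPk archSub Ψ act Mmod region n lat sig split qData tq t htq0 htq1
    pp i hr w c hw hc hcell

/-- **The trivial cell**: if `‖t_{q,x}‖ ≤ ‖t_{Θ,i+1,x}‖` at every place `x | p` (e.g. both ideles units — the good primes — or `p = 2`), then
`qRegion (i+1) p ⊆ thetaHull (i+1) p` (graded reach with `r = 1`, identity movers, `y = 1`). [cite: DupuyHilado2025, §3.9, §4.9]
[claim: Mochizuki2012, status: disputed] -/
theorem qRegion_subset_thetaHull_settingDHVolSharp_of_norm_le (pp : Nat.Primes) [Fact (pp : ℕ).Prime] (i : Fin (thetaIndex X).lstar)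
    (hle : ∀ x : (thetaIndex X).Fibre (.inr pp), ‖tq pp x‖ ≤ ‖t pp i x‖) :
    (settingDHVolSharp X hlog M archPk archSub Ψ act Mmod region n lat sig split qData tq t htq0 htq1).qRegion
        (Setting.labelSucc i) (.inr pp) ⊆
      (settingDHVolSharp X hlog M archPk archSub Ψ act Mmod region n lat sig split qData tq t htq0 htq1).thetaHull
        (Setting.labelSucc i) (.inr pp) :=
  qRegion_subset_thetaHull_settingDHVolSharp_of_gradedReach X hlog M archPk archSub Ψ act Mmod region n lat sig split qData tq t htq0 htq1
    pp i zero_le_one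
    (fun x => ⟨LinearEquiv.refl ℚ _, (logShellsDH X logv).one_mem_ism x.1, 1, norm_one.le, by
      rw [LinearEquiv.refl_apply, LinearEquiv.apply_symm_apply]
      exact le_of_eq (norm_one (α := kOf X pp.1 x)).symm⟩)
    fun x => ⟨LinearEquiv.refl ℚ _, (logShellsDH X logv).one_mem_ism x.1, 1, norm_one.le, by
      rw [mul_one, one_pow, mul_one, LinearEquiv.refl_apply, LinearEquiv.apply_symm_apply]
      exact hle x⟩

/-! ## §3. The Licence and branch C's hull-level antecedent from far-reach data -/

/-- **THE TYPED (xi-f) LICENCE AT `settingPrVolSharp` FROM FAR-REACH DATA.** If at every packet `(p, i+1)` EITHER `‖t_{q,x}‖ ≤ ‖t_{Θ,i+1,x}‖` at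
every `x | p` (trivial cell) OR the far-reach data of §2 are given (`r ≥ 0`; per place a non-zero log-unit `w_x` with `r ≤ p·‖w_x‖`, an integer
`c_x` with `‖p^{c_x}‖ ≤ ‖t_{Θ,i+1,x}‖`, and `‖t_{q,x}‖ ≤ p^{1−c_x}·‖w_x‖·r^{i+1}`), then abc-iut-c312-1's `Thm311ToCor312.Licence` holds at
abc-iut-c312-7's print-normalised sharp setting. [cite: DupuyHilado2025, §3.9, §4.9] [cite: Mochizuki2012, IUTchIII Cor. 3.12 Step (xi-f) p. 184]
[claim: Mochizuki2012, status: disputed] -/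
theorem licence_settingPrVolSharp_of_farReach
    (h : ∀ (pp : Nat.Primes) (i : Fin (thetaIndex X).lstar), haveI : Fact (pp : ℕ).Prime := ⟨pp.2⟩
      (∀ x : (thetaIndex X).Fibre (.inr pp), ‖tq pp x‖ ≤ ‖t pp i x‖) ∨
      ∃ (r : ℝ) (w : ∀ x : (thetaIndex X).Fibre (.inr pp), kOf X pp.1 x) (c : (thetaIndex X).Fibre (.inr pp) → ℤ),
        0 ≤ r ∧ (∀ x, w x ∈ logUnits (kOf X pp.1 x) ∧ w x ≠ 0 ∧ r ≤ (pp.1 : ℝ) * ‖w x‖) ∧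
        (∀ x, ‖((pp.1 : ℚ_[pp.1]) ^ c x)‖ ≤ ‖t pp i x‖) ∧
        (∀ x, ‖tq pp x‖ ≤ (pp.1 : ℝ) ^ (1 - c x) * ‖w x‖ * r ^ ((i : ℕ) + 1))) :
    Thm311ToCor312.Licence (settingPrVolSharp X hlog M archPk archSub Ψ act Mmod region n lat sig split qData tq t htq0 htq1) := by
  intro i vQ
  cases vQ with
  | inl u =>
    exact qRegion_subset_thetaHull_settingDHVolSharp_inl X hlog M archPk archSub Ψ act Mmod region n lat sig split qData tq t
      htq0 htq1 (Setting.labelSucc i) u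
  | inr pp =>
    haveI : Fact (pp : ℕ).Prime := ⟨pp.2⟩
    rcases h pp i with hle | ⟨r, w, c, hr, hw, hc, hcell⟩
    · exact qRegion_subset_thetaHull_settingDHVolSharp_of_norm_le X hlog M archPk archSub Ψ act Mmod region n lat sig split qData tq t
        htq0 htq1 pp i hle
    · exact qRegion_subset_thetaHull_settingDHVolSharp_of_farReach X hlog M archPk archSub Ψ act Mmod region n lat sig split qData tq t
        htq0 htq1 pp i hr w c hw hc hcell

/-- **BRANCH C's HULL-LEVEL ANTECEDENT «∃ ρ qK, QPinned ∧ PilotKummerCompatHull» AT `settingPrVolSharp` FROM FAR-REACH DATA** (any columns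
`col`; integral `q`-ideles for the label `0`, where the Θ-idele is `1`; C-cert-1 `Conditional.Antecedent.exists_qPinned_and_hull_iff`). This is
the shape in which the certificates of record (`Conditional.abc_of_SH_v10K_window` p447945 and descendants) consume their window binder `hSHw`.
[cite: DupuyHilado2025, §3.9, §4.9] [cite: Mochizuki2012, IUTchIII Cor. 3.12 Step (xi-d) p. 183, (xi-f) p. 184] [claim: Mochizuki2012, status: disputed] -/
theorem exists_qPinned_and_hull_settingPrVolSharp_of_farReach (htqle : ∀ pp x, ‖tq pp x‖ ≤ 1)
    (h : ∀ (pp : Nat.Primes) (i : Fin (thetaIndex X).lstar), haveI : Fact (pp : ℕ).Prime := ⟨pp.2⟩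
      (∀ x : (thetaIndex X).Fibre (.inr pp), ‖tq pp x‖ ≤ ‖t pp i x‖) ∨
      ∃ (r : ℝ) (w : ∀ x : (thetaIndex X).Fibre (.inr pp), kOf X pp.1 x) (c : (thetaIndex X).Fibre (.inr pp) → ℤ),
        0 ≤ r ∧ (∀ x, w x ∈ logUnits (kOf X pp.1 x) ∧ w x ≠ 0 ∧ r ≤ (pp.1 : ℝ) * ‖w x‖) ∧
        (∀ x, ‖((pp.1 : ℚ_[pp.1]) ^ c x)‖ ≤ ‖t pp i x‖) ∧
        (∀ x, ‖tq pp x‖ ≤ (pp.1 : ℝ) ^ (1 - c x) * ‖w x‖ * r ^ ((i : ℕ) + 1))) :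
    ∃ (ρ : (∀ v : (thetaIndex X).V, v ∈ (thetaIndex X).Vbad → Set ((logShellsDH X logv).StarPacket v)) →
          ∀ (j : (thetaIndex X).Label) (vQ : (thetaIndex X).VQ), Set ((logShellsDH X logv).Packet j vQ))
        (qK : ∀ v : (thetaIndex X).V, v ∈ (thetaIndex X).Vbad → Set ((logShellsDH X logv).StarPacket v)),
        QPinned ({ toSituation := situationPrVol X hlog M archPk archSub Ψ act Mmod region, col := col } :
            LatticeSituation (thetaIndex X))
          (settingPrVolSharp X hlog M archPk archSub Ψ act Mmod region n lat sig split qData tq t htq0 htq1) ρ qK ∧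
        PilotKummerCompatHull ({ toSituation := situationPrVol X hlog M archPk archSub Ψ act Mmod region, col := col } :
            LatticeSituation (thetaIndex X))
          (settingPrVolSharp X hlog M archPk archSub Ψ act Mmod region n lat sig split qData tq t htq0 htq1) ρ qK := by
  refine (Conditional.Antecedent.exists_qPinned_and_hull_iff
    ({ toSituation := situationPrVol X hlog M archPk archSub Ψ act Mmod region, col := col } : LatticeSituation (thetaIndex X))
    (settingPrVolSharp X hlog M archPk archSub Ψ act Mmod region n lat sig split qData tq t htq0 htq1)).2 fun j vQ => ?_
  by_cases hj : 0 < (j : ℕ)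
  · -- a label of `𝔽_l^⋇`: §2 / the trivial cell (finite places), the trivial archimedean container
    have hj' : j = Setting.labelSucc ⟨(j : ℕ) - 1, by have := j.2; simp only [thetaIndex] at this ⊢; omega⟩ := by
      ext; simp only [Setting.labelSucc, Fin.val_succ]; omega
    rw [hj']
    exact licence_settingPrVolSharp_of_farReach X hlog M archPk archSub Ψ act Mmod region n lat sig split qData tq t htq0 htq1 h _ vQ
  · -- the label `0`: Θ-idele `1`, identity mover for integral `t_q`
    refine qRegion_subset_thetaHull_settingDHVolSharp_of_movers X hlog M archPk archSub Ψ act Mmod region n lat sig split qData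
      tq t htq0 htq1 j vQ fun pp x => exists_mover_of_norm_le X hlog tq t pp j x ?_
    haveI : Fact (pp : ℕ).Prime := ⟨pp.2⟩
    unfold labelIdele
    rw [dif_neg hj, norm_one]
    exact htqle pp x

end Cell

end Summit.ABC.IUTFork.Thm311.Real

end
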